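import Summits.FinalStateConjecture.FinalStateConjecture.Statement
import Summits.FinalStateConjecture.FinalStateConjecture.Theorems.PhotonSphereChannelsTameCensorshipResidualAnd
import Summits.FinalStateConjecture.FinalStateConjecture.Theorems.PhotonSphereChannelsTameCensorshipResidualMono
import Summits.FinalStateConjecture.FinalStateConjecture.Theorems.PhotonSphereChannelsTameCensorshipResidualTransport
import Summits.FinalStateConjecture.FinalStateConjecture.Theorems.PhotonSphereChannelsTameCensorshipResidualOfRobust
import Summits.FinalStateConjecture.FinalStateConjecture.Theorems.PhotonSphereChannelsTameCensorshipPathOfResidual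
import Summits.FinalStateConjecture.FinalStateConjecture.Theorems.PhotonSphereChannelsTameCensorshipProbeTransport
import Summits.FinalStateConjecture.FinalStateConjecture.Theorems.PhotonSphereChannelsTameCensorshipWitnessOfGoodPath
import Summits.FinalStateConjecture.FinalStateConjecture.Theorems.PhotonSphereChannelsTameCensorshipQK3ComapIff
import Summits.FinalStateConjecture.FinalStateConjecture.Theorems.PhotonSphereChannelsTameCensorshipExistsTimeReverse
import Summits.FinalStateConjecture.FinalStateConjecture.Theorems.PhotonSphereChannelsTameCensorshipReverseDevelopment
import Summits.FinalStateConjecture.FinalStateConjecture.Theorems.PhotonSphereChannelsTameCensorshipOrientationDichotomy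
import Literature.Geometry.Lorentzian.SpacetimeReverse

/-!
# Route PhotonSphereChannels · crux `TameCensorship` (stmt-FinalStateConjecture-17431, K3 tame form) ·
# THE SPLIT THEOREM (crux-strategist, 2026-08-17): K3 from four clause-wise pieces, Theses-free and def-free

Glue file for the D-0019 glued split of the crux `Theses.PhotonSphereChannels.TameCensorship` filed by the
crux-strategist seat (`ledger route edit … --split TameCensorship --into … --glue-by tameCensorship_of_subs`). It is the
RESIDUAL (v9) form of the lead's landed composition `TameCensorshipUnwind.tameCensorship_of_robustKernels`
(Theorems/PhotonSphereChannelsTameCensorshipOfRobustKernels.lean, p154904), rebuilt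

* THESES-FREE — it imports neither `Theses.PhotonSphereChannels` nor `Theses.RobustClausewiseGenericity`, so the gate
  can import THIS module into the route file without the import cycle that a Theses-importing glue creates; the
  conclusion is the body of `TameCensorship` verbatim and hypotheses 3–4 are the bodies of the shared items
  `MGHDExists` (stmt-FinalStateConjecture-9937) and `CensorshipRobust` (stmt-FinalStateConjecture-10131) verbatim;
* over the RESIDUAL legend — hypotheses 1–2 are VERBATIM the two open kernel stubs of the registered skeleton v9 of
  line `Sketch` (`stub_fgExtremalChartFreeResidual`, `stub_tameOuterResidual`, skeleton sha c44c6ad0…, 2026-08-17T10:51Z):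
  residual escapability asks, along every further enrichment of an enriched probe, for a RESIDUAL (comeagre) set of
  good radial directions instead of an open dense one. It is implied by the robust (open-dense) form
  (`stub_residualOfRobust`, p155981), is still closed under finite conjunction (`stub_residualAnd`) and monotone
  (`stub_residualMono`), transports along the data involution `(h, k) ↦ (h, −k)` (`stub_residualTransport`, p155993),
  and still yields a compactly supported admissible path of good small members by Baire (`stub_pathOfResidual`,
  p156048) — so it assembles exactly as the robust legend does, while surviving countable accumulation of exceptional
  walls (the "Cantor / one-sided accumulation" failure mode named in the why-might-fail of stmt-10131 and stmt-10132).

Content (proofs are the lead's, brick for brick, with the residual bricks substituted):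
* `isTameChristodoulouGeneric_of_residual` (private) — the abstract engine: residual escapability of `Q` at every
  admissible datum + (`Q ⇒ P` on admissible data) + gauge invariance of `P` ⇒ `IsTameChristodoulouGeneric 𝓓 P 1`
  (`stub_pathOfResidual` + `stub_witnessOfGoodPath` p136319);
* `residual_extremalChartFree_of_fg` (private) — residual clause (i) (orientation-blind, `Set.univ`-targeted, as K3
  types it) at every admissible datum from the residual FUTURE-GOING half at every admissible datum (data involution
  `stub_exists_timeReverse` p148248, `stub_probeTransport` p154120, `stub_residualTransport`, `stub_residualAnd`,
  `stub_residualMono`, MGHD reversal `stub_exists_reverse_development` p148572, `stub_orientationDichotomy` p149346);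
* `tameCensorship_of_subs` — **K3 ⇐ [FG-residual third law, late-chart form] ∧ [residual tame outer region] ∧
  [MGHD existence] ∧ [robust censorship]**: the typed split `FGExtremalChartFreeResidual → TameOuterResidual →
  MGHDExists → CensorshipRobust → TameCensorship` of the route edit, every decl replaced by its body.

Nothing is claimed about the two kernels (open problems: the future-going dynamical third law in late-chart form —
Kehle–Unger arXiv:2402.10190, Angelopoulos–Kehle–Unger arXiv:2410.16234 — and a-priori `C³` tameness of the outer
region, no mechanism in print); the file certifies that the crux is a pure glue node over them and the two shared
items. [folklore]
-/

set_option linter.dupNamespace false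
-- instance search through the nested operator type `E4 →L[ℝ] E4 →L[ℝ] ℝ` of metric components (as in the chart files)
set_option maxSynthPendingDepth 3

open Literature.Geometry.Lorentzian
open scoped Manifold ContDiff Topology
open Filter Set Function

noncomputable section

namespace Summit.FinalStateConjecture.FinalStateConjecture.Theorems.PhotonSphereChannels.TameCensorshipSplit

open Summit.FinalStateConjecture.FinalStateConjecture.Theorems.PhotonSphereChannels.TameCensorshipUnwind

/-- **Tame genericity from residual escapability (abstract engine, residual legend).** On the connected `3`-manifold
`X`, let `Q`, `P` be properties of initial data such that `P` is invariant under re-indexing an admissible datum by a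
diffeomorphism of `X` and `Q ⇒ P` on admissible data. If `Q` is RESIDUALLY escapable at every admissible datum (every
compactly supported smooth admissible probe through `d` enriches, along an injective linear map of parameter spaces, to one
along all of whose further enrichments a residual set of radial directions is `Q`-good for all small non-zero parameters),
then `P` is tame-Christodoulou-generic with codimension `1` on `admissibleVacuumData X`: at an exceptional admissible `d`,
residual escapability yields a compactly supported smooth admissible path through `d` with `Q`-good (hence `P`-good) small
non-zero members (`stub_pathOfResidual`, Baire), which is sheared into a tame, immersed, injective admissible curve with
`P`-good non-zero members (`stub_witnessOfGoodPath`); it meets the exceptional set only at `0`. Residual copy of the lead's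
`TameCensorshipUnwind.isTameChristodoulouGeneric_of_robust` (p154904). [folklore] -/
private theorem isTameChristodoulouGeneric_of_residual :
    ∀ (X : Type) [TopologicalSpace X] [ChartedSpace E3 X] [IsManifold (𝓡 3) ∞ X] [T2Space X]
    [SecondCountableTopology X] [ConnectedSpace X] (Q P : InitialDataSet (𝓡 3) X → Prop), (∀ (D : InitialDataSet
    (𝓡 3) X) (Φ : X ≃ₜ X) (hΦ : ContMDiff (𝓡 3) (𝓡 3) (∞ + 1) Φ) (hΦ' : ∀ u, Injective (mfderiv (𝓡 3) (𝓡 3) Φ u)),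
    ContMDiff (𝓡 3) (𝓡 3) (∞ + 1) Φ.symm → (∀ u, Injective (mfderiv (𝓡 3) (𝓡 3) Φ.symm u)) → D ∈
    admissibleVacuumData X → P D → P (D.comap Φ hΦ hΦ')) → (∀ D ∈ admissibleVacuumData X, Q D → P D) → (∀ d ∈
    admissibleVacuumData X, ∀ (m : ℕ) (G : EuclideanSpace ℝ (Fin m) → InitialDataSet (𝓡 3) X),
    (InitialDataSet.IsSmoothDataFamily m G ∧ G 0 = d ∧ (∀ c, G c ∈ admissibleVacuumData X) ∧ ∃ K : Set X,
    IsCompact K ∧ ∀ c, ∀ x ∉ K, (G c).h.inner x = d.h.inner x ∧ (G c).k x = d.k x) → ∃ (n : ℕ) (G₁ :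
    EuclideanSpace ℝ (Fin n) → InitialDataSet (𝓡 3) X) (L : EuclideanSpace ℝ (Fin m) →ₗ[ℝ] EuclideanSpace ℝ (Fin
    n)), Function.Injective L ∧ (InitialDataSet.IsSmoothDataFamily n G₁ ∧ G₁ 0 = d ∧ (∀ c, G₁ c ∈
    admissibleVacuumData X) ∧ ∃ K : Set X, IsCompact K ∧ ∀ c, ∀ x ∉ K, (G₁ c).h.inner x = d.h.inner x ∧ (G₁ c).k x
    = d.k x) ∧ (∀ c, G₁ (L c) = G c) ∧ ∀ (p : ℕ) (G₂ : EuclideanSpace ℝ (Fin p) → InitialDataSet (𝓡 3) X) (L' :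
    EuclideanSpace ℝ (Fin n) →ₗ[ℝ] EuclideanSpace ℝ (Fin p)), Function.Injective L' →
    (InitialDataSet.IsSmoothDataFamily p G₂ ∧ G₂ 0 = d ∧ (∀ c, G₂ c ∈ admissibleVacuumData X) ∧ ∃ K : Set X,
    IsCompact K ∧ ∀ c, ∀ x ∉ K, (G₂ c).h.inner x = d.h.inner x ∧ (G₂ c).k x = d.k x) → (∀ c, G₂ (L' c) = G₁ c) → ∃
    U : Set (EuclideanSpace ℝ (Fin p)), U ∈ residual (EuclideanSpace ℝ (Fin p)) ∧ ∀ v ∈ U, ∃ δ : ℝ, 0 < δ ∧ ∀ t : ℝ, t ≠ 0 → |t| < δ →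
    Q (G₂ (t • v))) → InitialDataSet.IsTameChristodoulouGeneric (admissibleVacuumData X) P 1 := by
  intro X _ _ _ _ _ _ Q P hgauge hQP hrob d hd
  obtain ⟨G, hG, hG0, hadm, hK, ε, hε, hgood⟩ := stub_pathOfResidual X d Q hd.1 (hrob d hd.1)
  obtain ⟨e, F, hF, himm, hF0, hinj, hFadm, hPgood⟩ :=
    stub_witnessOfGoodPath X P hgauge d G hG hG0 hd.1 hadm hK
      ⟨ε, hε, fun c hc hcε => hQP _ (hadm c) (hgood c hc hcε)⟩
  exact ⟨e, F, hF, himm, hF0, hinj, hFadm, fun c hc hmem => hmem.2 (hPgood c hc)⟩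

/-- Transfer of the future-going half of clause (i) from a vacuum Cauchy development `𝒟'` to any spacetime EQUAL to
`𝒟'.toSpacetime` (used with `𝒟'.toSpacetime = 𝒟.toSpacetime.reverse` from `stub_exists_reverse_development`; the development-level
and spacetime-level spellings of the clause agree definitionally). [folklore] -/
private theorem fgExtremalChartFree_of_toSpacetime_eq :
    ∀ (X : Type) [TopologicalSpace X] [ChartedSpace E3 X] [IsManifold (𝓡 3) ∞ X] [T2Space X]
    [SecondCountableTopology X] [ConnectedSpace X] (D' : InitialDataSet (𝓡 3) X) (𝒟' : VacuumCauchyDevelopment D')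
    (𝓣 : Spacetime.{0} 4), 𝒟'.toSpacetime = 𝓣 → (∀ (Λ : lorentzGroup) (c : E4) (M a : ℝ), Kerr.IsExtremal M a → ¬
    ∃ (τ₀ : ℝ) (Ψ : (boostedKerrBackground Λ c M a).domain → 𝒟'.carrier), 𝒟'.toSpacetime.IsLateChart
    (boostedKerrBackground Λ c M a) Set.univ τ₀ Ψ ∧ (∀ ρ : ℝ, ∀ᶠ τ in Filter.atTop, ∀ x ∈ (boostedKerrBackground Λ
    c M a).truncTimeSlab ρ τ, 𝒟'.timeOrientation.IsFutureDirected (mfderiv 𝓘(ℝ, E4) (𝓡 4) Ψ x ((Λ : E4 ≃L[ℝ] E4)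
    (Kerr.timeVector M a (poincareInv Λ c (x : E4)))))) ∧ ∀ R : ℝ, Filter.Tendsto (fun τ =>
    𝒟'.toSpacetime.truncDeviationCk (boostedKerrBackground Λ c M a) Ψ 2 R τ) Filter.atTop (nhds 0)) → ∀ (Λ :
    lorentzGroup) (c : E4) (M a : ℝ), Kerr.IsExtremal M a → ¬ ∃ (τ₀ : ℝ) (Ψ : (boostedKerrBackground Λ c M
    a).domain → 𝓣.carrier), 𝓣.IsLateChart (boostedKerrBackground Λ c M a) Set.univ τ₀ Ψ ∧ (∀ ρ : ℝ, ∀ᶠ τ in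
    Filter.atTop, ∀ x ∈ (boostedKerrBackground Λ c M a).truncTimeSlab ρ τ, 𝓣.timeOrientation.IsFutureDirected
    (mfderiv 𝓘(ℝ, E4) (𝓡 4) Ψ x ((Λ : E4 ≃L[ℝ] E4) (Kerr.timeVector M a (poincareInv Λ c (x : E4)))))) ∧ ∀ R : ℝ,
    Filter.Tendsto (fun τ => 𝓣.truncDeviationCk (boostedKerrBackground Λ c M a) Ψ 2 R τ) Filter.atTop (nhds 0) := by
  intro X _ _ _ _ _ _ D' 𝒟' 𝓣 hS h
  subst hS
  exact h

/-- **Residual clause (i) from its future-going half.** Clause (i) of K3 for an MGHD — no late chart modelled on a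
boosted EXTREMAL Kerr exterior with truncated `C²` deviation `→ 0` — carries no orientation token, so its residual form at
a datum silently contains a PAST third law. If the FUTURE-GOING half (push-forward of the boosted Kerr–Schild time vector
`Λ V_{M,a}` eventually future-directed on every truncated slab) is residually escapable at EVERY admissible datum, then so
is clause (i): with the data involution `rev = (h, k) ↦ (h, −k)` (chosen from `stub_exists_timeReverse`; `rev ∘ rev = id`
by extensionality), the future-going half at `rev d` transports to "future-going half of every MGHD of `rev D`" at `d`
(`stub_probeTransport`, `stub_residualTransport`), conjoins with the half at `d` (`stub_residualAnd`), and upgrades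
pointwise (`stub_residualMono`): an extremal late chart of an MGHD `𝒟` of `D` is future-going for `𝒟` — excluded — or for
`𝒟.reverse` (`stub_orientationDichotomy`, `0 ≤ M` from `Kerr.IsExtremal`), which is an MGHD of `rev D`
(`stub_exists_reverse_development`) where it is a late chart with the same deviations (`Spacetime.reverse_isLateChart_iff`)
— excluded. Residual copy of the lead's `TameCensorshipUnwind.robust_extremalChartFree_of_fg` (p154904). [folklore] -/
private theorem residual_extremalChartFree_of_fg :
    (∀ (X : Type) [TopologicalSpace X] [ChartedSpace E3 X] [IsManifold (𝓡 3) ∞ X] [T2Space X]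
    [SecondCountableTopology X] [ConnectedSpace X], ∀ d ∈ admissibleVacuumData X, ∀ (m : ℕ) (G : EuclideanSpace ℝ
    (Fin m) → InitialDataSet (𝓡 3) X), (InitialDataSet.IsSmoothDataFamily m G ∧ G 0 = d ∧ (∀ c, G c ∈
    admissibleVacuumData X) ∧ ∃ K : Set X, IsCompact K ∧ ∀ c, ∀ x ∉ K, (G c).h.inner x = d.h.inner x ∧ (G c).k x =
    d.k x) → ∃ (n : ℕ) (G₁ : EuclideanSpace ℝ (Fin n) → InitialDataSet (𝓡 3) X) (L : EuclideanSpace ℝ (Fin m)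
    →ₗ[ℝ] EuclideanSpace ℝ (Fin n)), Function.Injective L ∧ (InitialDataSet.IsSmoothDataFamily n G₁ ∧ G₁ 0 = d ∧
    (∀ c, G₁ c ∈ admissibleVacuumData X) ∧ ∃ K : Set X, IsCompact K ∧ ∀ c, ∀ x ∉ K, (G₁ c).h.inner x = d.h.inner x
    ∧ (G₁ c).k x = d.k x) ∧ (∀ c, G₁ (L c) = G c) ∧ ∀ (p : ℕ) (G₂ : EuclideanSpace ℝ (Fin p) → InitialDataSet (𝓡
    3) X) (L' : EuclideanSpace ℝ (Fin n) →ₗ[ℝ] EuclideanSpace ℝ (Fin p)), Function.Injective L' →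
    (InitialDataSet.IsSmoothDataFamily p G₂ ∧ G₂ 0 = d ∧ (∀ c, G₂ c ∈ admissibleVacuumData X) ∧ ∃ K : Set X,
    IsCompact K ∧ ∀ c, ∀ x ∉ K, (G₂ c).h.inner x = d.h.inner x ∧ (G₂ c).k x = d.k x) → (∀ c, G₂ (L' c) = G₁ c) → ∃
    U : Set (EuclideanSpace ℝ (Fin p)), U ∈ residual (EuclideanSpace ℝ (Fin p)) ∧ ∀ v ∈ U, ∃ δ : ℝ, 0 < δ ∧ ∀ t : ℝ, t ≠ 0 → |t| < δ →
    ∀ 𝒟 : VacuumCauchyDevelopment (G₂ (t • v)), 𝒟.IsMaximal → ∀ (Λ : lorentzGroup) (c : E4) (M a : ℝ),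
    Kerr.IsExtremal M a → ¬ ∃ (τ₀ : ℝ) (Ψ : (boostedKerrBackground Λ c M a).domain → 𝒟.carrier),
    𝒟.toSpacetime.IsLateChart (boostedKerrBackground Λ c M a) Set.univ τ₀ Ψ ∧ (∀ ρ : ℝ, ∀ᶠ τ in Filter.atTop, ∀ x
    ∈ (boostedKerrBackground Λ c M a).truncTimeSlab ρ τ, 𝒟.timeOrientation.IsFutureDirected (mfderiv 𝓘(ℝ, E4) (𝓡
    4) Ψ x ((Λ : E4 ≃L[ℝ] E4) (Kerr.timeVector M a (poincareInv Λ c (x : E4)))))) ∧ ∀ R : ℝ, Filter.Tendsto (fun τ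
    => 𝒟.toSpacetime.truncDeviationCk (boostedKerrBackground Λ c M a) Ψ 2 R τ) Filter.atTop (nhds 0)) → ∀ (X :
    Type) [TopologicalSpace X] [ChartedSpace E3 X] [IsManifold (𝓡 3) ∞ X] [T2Space X] [SecondCountableTopology X]
    [ConnectedSpace X], ∀ d ∈ admissibleVacuumData X, ∀ (m : ℕ) (G : EuclideanSpace ℝ (Fin m) → InitialDataSet (𝓡
    3) X), (InitialDataSet.IsSmoothDataFamily m G ∧ G 0 = d ∧ (∀ c, G c ∈ admissibleVacuumData X) ∧ ∃ K : Set X,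
    IsCompact K ∧ ∀ c, ∀ x ∉ K, (G c).h.inner x = d.h.inner x ∧ (G c).k x = d.k x) → ∃ (n : ℕ) (G₁ :
    EuclideanSpace ℝ (Fin n) → InitialDataSet (𝓡 3) X) (L : EuclideanSpace ℝ (Fin m) →ₗ[ℝ] EuclideanSpace ℝ (Fin
    n)), Function.Injective L ∧ (InitialDataSet.IsSmoothDataFamily n G₁ ∧ G₁ 0 = d ∧ (∀ c, G₁ c ∈
    admissibleVacuumData X) ∧ ∃ K : Set X, IsCompact K ∧ ∀ c, ∀ x ∉ K, (G₁ c).h.inner x = d.h.inner x ∧ (G₁ c).k x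
    = d.k x) ∧ (∀ c, G₁ (L c) = G c) ∧ ∀ (p : ℕ) (G₂ : EuclideanSpace ℝ (Fin p) → InitialDataSet (𝓡 3) X) (L' :
    EuclideanSpace ℝ (Fin n) →ₗ[ℝ] EuclideanSpace ℝ (Fin p)), Function.Injective L' →
    (InitialDataSet.IsSmoothDataFamily p G₂ ∧ G₂ 0 = d ∧ (∀ c, G₂ c ∈ admissibleVacuumData X) ∧ ∃ K : Set X,
    IsCompact K ∧ ∀ c, ∀ x ∉ K, (G₂ c).h.inner x = d.h.inner x ∧ (G₂ c).k x = d.k x) → (∀ c, G₂ (L' c) = G₁ c) → ∃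
    U : Set (EuclideanSpace ℝ (Fin p)), U ∈ residual (EuclideanSpace ℝ (Fin p)) ∧ ∀ v ∈ U, ∃ δ : ℝ, 0 < δ ∧ ∀ t : ℝ, t ≠ 0 → |t| < δ →
    ∀ 𝒟 : VacuumCauchyDevelopment (G₂ (t • v)), 𝒟.IsMaximal → (∀ (Λ : lorentzGroup) (c : E4) (M a : ℝ),
    Kerr.IsExtremal M a → ¬ ∃ (τ₀ : ℝ) (Ψ : (boostedKerrBackground Λ c M a).domain → 𝒟.carrier),
    𝒟.toSpacetime.IsLateChart (boostedKerrBackground Λ c M a) Set.univ τ₀ Ψ ∧ ∀ R : ℝ, Filter.Tendsto (fun τ =>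
    𝒟.toSpacetime.truncDeviationCk (boostedKerrBackground Λ c M a) Ψ 2 R τ) Filter.atTop (nhds 0)) := by
  intro hFG X _ _ _ _ _ _ d hd
  -- the data involution `rev = (h, k) ↦ (h, −k)` and its involutivity
  choose rev hrev_h hrev_k using stub_exists_timeReverse X
  have hrr : ∀ D : InitialDataSet (𝓡 3) X, rev (rev D) = D := by
    intro D
    rcases hrD : rev (rev D) with ⟨h₁, k₁, hk₁⟩
    rcases hD : D with ⟨h₂, k₂, hk₂⟩
    have hh : h₁ = h₂ := by
      have := (hrev_h (rev D)).trans (hrev_h D)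
      rw [hrD, hD] at this
      exact this
    have hk : k₁ = k₂ := by
      funext x
      ext v w
      have := hrev_k (rev D) x v w
      rw [hrev_k D x v w, neg_neg, hrD, hD] at this
      exact this
    cases hh
    cases hk
    rfl
  have hprobe := stub_probeTransport X rev hrev_h hrev_k
  have hrevadm : rev d ∈ admissibleVacuumData X :=
    stub_timeReverse_admissible X d (rev d) (hrev_h d) (hrev_k d) hd
  -- the future-going half at `d`, and at `rev d` transported back to `d`
  have h₁ := hFG X d hd
  have h₂ := stub_residualTransport X rev hrr hprobe d
    (fun D => ∀ 𝒟 : VacuumCauchyDevelopment D, 𝒟.IsMaximal → ∀ (Λ : lorentzGroup) (c : E4) (M a : ℝ),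
    Kerr.IsExtremal M a → ¬ ∃ (τ₀ : ℝ) (Ψ : (boostedKerrBackground Λ c M a).domain → 𝒟.carrier),
    𝒟.toSpacetime.IsLateChart (boostedKerrBackground Λ c M a) Set.univ τ₀ Ψ ∧ (∀ ρ : ℝ, ∀ᶠ τ in Filter.atTop, ∀ x
    ∈ (boostedKerrBackground Λ c M a).truncTimeSlab ρ τ, 𝒟.timeOrientation.IsFutureDirected (mfderiv 𝓘(ℝ, E4) (𝓡
    4) Ψ x ((Λ : E4 ≃L[ℝ] E4) (Kerr.timeVector M a (poincareInv Λ c (x : E4)))))) ∧ ∀ R : ℝ, Filter.Tendsto (fun τ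
    => 𝒟.toSpacetime.truncDeviationCk (boostedKerrBackground Λ c M a) Ψ 2 R τ) Filter.atTop (nhds 0)) (hFG X (rev d) hrevadm)
  -- conjoin and upgrade pointwise by the orientation dichotomy
  refine stub_residualMono X d
    (fun D => (∀ 𝒟 : VacuumCauchyDevelopment D, 𝒟.IsMaximal → ∀ (Λ : lorentzGroup) (c : E4) (M a : ℝ),
    Kerr.IsExtremal M a → ¬ ∃ (τ₀ : ℝ) (Ψ : (boostedKerrBackground Λ c M a).domain → 𝒟.carrier),
    𝒟.toSpacetime.IsLateChart (boostedKerrBackground Λ c M a) Set.univ τ₀ Ψ ∧ (∀ ρ : ℝ, ∀ᶠ τ in Filter.atTop, ∀ x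
    ∈ (boostedKerrBackground Λ c M a).truncTimeSlab ρ τ, 𝒟.timeOrientation.IsFutureDirected (mfderiv 𝓘(ℝ, E4) (𝓡
    4) Ψ x ((Λ : E4 ≃L[ℝ] E4) (Kerr.timeVector M a (poincareInv Λ c (x : E4)))))) ∧ ∀ R : ℝ, Filter.Tendsto (fun τ
    => 𝒟.toSpacetime.truncDeviationCk (boostedKerrBackground Λ c M a) Ψ 2 R τ) Filter.atTop (nhds 0)) ∧ (∀ 𝒟 :
    VacuumCauchyDevelopment (rev D), 𝒟.IsMaximal → ∀ (Λ : lorentzGroup) (c : E4) (M a : ℝ), Kerr.IsExtremal M a →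
    ¬ ∃ (τ₀ : ℝ) (Ψ : (boostedKerrBackground Λ c M a).domain → 𝒟.carrier), 𝒟.toSpacetime.IsLateChart
    (boostedKerrBackground Λ c M a) Set.univ τ₀ Ψ ∧ (∀ ρ : ℝ, ∀ᶠ τ in Filter.atTop, ∀ x ∈ (boostedKerrBackground Λ
    c M a).truncTimeSlab ρ τ, 𝒟.timeOrientation.IsFutureDirected (mfderiv 𝓘(ℝ, E4) (𝓡 4) Ψ x ((Λ : E4 ≃L[ℝ] E4)
    (Kerr.timeVector M a (poincareInv Λ c (x : E4)))))) ∧ ∀ R : ℝ, Filter.Tendsto (fun τ =>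
    𝒟.toSpacetime.truncDeviationCk (boostedKerrBackground Λ c M a) Ψ 2 R τ) Filter.atTop (nhds 0)))
    (fun D => ∀ 𝒟 : VacuumCauchyDevelopment D, 𝒟.IsMaximal → ∀ (Λ : lorentzGroup) (c : E4) (M a : ℝ),
    Kerr.IsExtremal M a → ¬ ∃ (τ₀ : ℝ) (Ψ : (boostedKerrBackground Λ c M a).domain → 𝒟.carrier),
    𝒟.toSpacetime.IsLateChart (boostedKerrBackground Λ c M a) Set.univ τ₀ Ψ ∧ ∀ R : ℝ, Filter.Tendsto (fun τ =>
    𝒟.toSpacetime.truncDeviationCk (boostedKerrBackground Λ c M a) Ψ 2 R τ) Filter.atTop (nhds 0))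
    (fun D _ h 𝒟 hmax => ?_)
    (stub_residualAnd X d
      (fun D => ∀ 𝒟 : VacuumCauchyDevelopment D, 𝒟.IsMaximal → ∀ (Λ : lorentzGroup) (c : E4) (M a : ℝ),
      Kerr.IsExtremal M a → ¬ ∃ (τ₀ : ℝ) (Ψ : (boostedKerrBackground Λ c M a).domain → 𝒟.carrier),
      𝒟.toSpacetime.IsLateChart (boostedKerrBackground Λ c M a) Set.univ τ₀ Ψ ∧ (∀ ρ : ℝ, ∀ᶠ τ in Filter.atTop, ∀
      x ∈ (boostedKerrBackground Λ c M a).truncTimeSlab ρ τ, 𝒟.timeOrientation.IsFutureDirected (mfderiv 𝓘(ℝ, E4)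
      (𝓡 4) Ψ x ((Λ : E4 ≃L[ℝ] E4) (Kerr.timeVector M a (poincareInv Λ c (x : E4)))))) ∧ ∀ R : ℝ, Filter.Tendsto
      (fun τ => 𝒟.toSpacetime.truncDeviationCk (boostedKerrBackground Λ c M a) Ψ 2 R τ) Filter.atTop (nhds 0))
      (fun D => ∀ 𝒟 : VacuumCauchyDevelopment (rev D), 𝒟.IsMaximal → ∀ (Λ : lorentzGroup) (c : E4) (M a : ℝ),
      Kerr.IsExtremal M a → ¬ ∃ (τ₀ : ℝ) (Ψ : (boostedKerrBackground Λ c M a).domain → 𝒟.carrier),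
      𝒟.toSpacetime.IsLateChart (boostedKerrBackground Λ c M a) Set.univ τ₀ Ψ ∧ (∀ ρ : ℝ, ∀ᶠ τ in Filter.atTop, ∀
      x ∈ (boostedKerrBackground Λ c M a).truncTimeSlab ρ τ, 𝒟.timeOrientation.IsFutureDirected (mfderiv 𝓘(ℝ, E4)
      (𝓡 4) Ψ x ((Λ : E4 ≃L[ℝ] E4) (Kerr.timeVector M a (poincareInv Λ c (x : E4)))))) ∧ ∀ R : ℝ, Filter.Tendsto
      (fun τ => 𝒟.toSpacetime.truncDeviationCk (boostedKerrBackground Λ c M a) Ψ 2 R τ) Filter.atTop (nhds 0)) h₁ h₂)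
  rintro Λ c M a hMa ⟨τ₀, Ψ, hΨ, hdev⟩
  rcases stub_orientationDichotomy 𝒟.toSpacetime Λ c M a hMa.2.le Ψ hΨ.contMDiff hdev with htok | htok
  · exact h.1 𝒟 hmax Λ c M a hMa ⟨τ₀, Ψ, hΨ, htok, hdev⟩
  · obtain ⟨𝒟', hmax', hS⟩ := stub_exists_reverse_development X D (rev D) (hrev_h D) (hrev_k D) 𝒟 hmax
    have h' := fgExtremalChartFree_of_toSpacetime_eq X (rev D) 𝒟' 𝒟.toSpacetime.reverse hS (h.2 𝒟' hmax')
    exact h' Λ c M a hMa ⟨τ₀, Ψ, (𝒟.toSpacetime.reverse_isLateChart_iff _ _ τ₀ Ψ).2 hΨ, htok, hdev⟩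

section SplitGlue

/-! ### File-local notations for the split theorem
The hypotheses and conclusion of `tameCensorship_of_subs` are, verbatim, the statements of the two registered kernel
stubs of line `Sketch` and the bodies of the route decls `MGHDExists` (stmt-9937), `CensorshipRobust` (stmt-10131),
`TameCensorship` (stmt-17431); below they are spelt through file-local NOTATIONS (pure syntax — nothing is defined,
the elaborated statement is literally the def-free one), which keeps the theorem header within the gate's stub
registry. Dotted projections of notation parameters are written `(𝒟).carrier`, `(d).k`, … -/

set_option quotPrecheck false in
/-- `extFree(𝒟)`: clause (i) of K3 for the development `𝒟` — no late chart modelled on a boosted extremal Kerr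
exterior with truncated `C²` deviation `→ 0` (orientation-blind, `Set.univ`-targeted). -/
local notation "extFree(" 𝒟 ")" =>
    ∀ (Λ : lorentzGroup) (c : E4) (M a : ℝ), Kerr.IsExtremal M a →
    ¬ ∃ (τ₀ : ℝ) (Ψ : (boostedKerrBackground Λ c M a).domain → (𝒟).carrier), (𝒟).toSpacetime.IsLateChart
    (boostedKerrBackground Λ c M a) Set.univ τ₀ Ψ ∧ ∀ R : ℝ, Filter.Tendsto (fun τ => (𝒟).toSpacetime.truncDeviationCk
    (boostedKerrBackground Λ c M a) Ψ 2 R τ) Filter.atTop (nhds 0)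

set_option quotPrecheck false in
/-- `outerTame(X, 𝒟)`: clause (ii) of K3 for the development `𝒟` of a datum on `X` — `C³`-bounded geometry of
`outer = J⁺(ιΣ) ∩ ⋃ I⁻(future-complete normalised rays)` at one scale, `C⁰`-deviation `≤ ½`. -/
local notation "outerTame(" X ", " 𝒟 ")" =>
    ∀ [(𝒟).metric.HasLeviCivita],
    let outer : Set (𝒟).carrier := (𝒟).metric.causalFuture (𝒟).timeOrientation (Set.range (𝒟).embed) ∩ {q | ∃ (p : X) (γ :
        ℝ → (𝒟).carrier) (dom : Set ℝ), (𝒟).metric.IsNormalisedNullRayFrom (𝒟).timeOrientation (𝒟).embed (𝒟).normal p γ dom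
        ∧ ¬ BddAbove dom ∧ q ∈ (𝒟).metric.chronologicalPast (𝒟).timeOrientation (γ '' (dom ∩ Set.Ici 0))};
    ∃ r₀ : ℝ, 0 < r₀ ∧ ∃ Λ : NNReal, ∀ q ∈ outer,
    let U : TopologicalSpace.Opens E4 := ⟨Metric.ball (0 : E4) r₀, Metric.isOpen_ball⟩;
    ∃ Ψ : U → (𝒟).carrier, (𝒟).toSpacetime.IsLateChart (Minkowski.backgroundOn U) Set.univ (-r₀) Ψ ∧ (∃ x : U, (x :
    E4) = 0 ∧ Ψ x = q) ∧ supCkENorm (U : Set E4) 3 ((𝒟).toSpacetime.deviationExtend (Minkowski.backgroundOn U) Ψ) ≤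
    (Λ : ENNReal) ∧ supCkENorm (U : Set E4) 0 ((𝒟).toSpacetime.deviationExtend (Minkowski.backgroundOn U) Ψ) ≤ 1
    / 2

set_option quotPrecheck false in
/-- `residFG(X, d)`: the future-going RESIDUAL dynamical third law at the datum `d` — verbatim the registered kernel
stub `stub_fgExtremalChartFreeResidual` (line `Sketch`, skeleton v9) after `∀ d ∈ admissibleVacuumData X,`. -/
local notation "residFG(" X ", " d ")" =>
    ∀ (m : ℕ) (G : EuclideanSpace ℝ
    (Fin m) → InitialDataSet (𝓡 3) X), (InitialDataSet.IsSmoothDataFamily m G ∧ G 0 = d ∧ (∀ c, G c ∈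
    admissibleVacuumData X) ∧ ∃ K : Set X, IsCompact K ∧ ∀ c, ∀ x ∉ K, (G c).h.inner x = (d).h.inner x ∧ (G c).k x =
    (d).k x) → ∃ (n : ℕ) (G₁ : EuclideanSpace ℝ (Fin n) → InitialDataSet (𝓡 3) X) (L : EuclideanSpace ℝ (Fin m)
    →ₗ[ℝ] EuclideanSpace ℝ (Fin n)), Injective L ∧ (InitialDataSet.IsSmoothDataFamily n G₁ ∧ G₁ 0 = d ∧ (∀ c, G₁ c
    ∈ admissibleVacuumData X) ∧ ∃ K : Set X, IsCompact K ∧ ∀ c, ∀ x ∉ K, (G₁ c).h.inner x = (d).h.inner x ∧ (G₁ c).k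
    x = (d).k x) ∧ (∀ c, G₁ (L c) = G c) ∧ ∀ (p : ℕ) (G₂ : EuclideanSpace ℝ (Fin p) → InitialDataSet (𝓡 3) X) (L' :
    EuclideanSpace ℝ (Fin n) →ₗ[ℝ] EuclideanSpace ℝ (Fin p)), Injective L' → (InitialDataSet.IsSmoothDataFamily p
    G₂ ∧ G₂ 0 = d ∧ (∀ c, G₂ c ∈ admissibleVacuumData X) ∧ ∃ K : Set X, IsCompact K ∧ ∀ c, ∀ x ∉ K, (G₂ c).h.inner
    x = (d).h.inner x ∧ (G₂ c).k x = (d).k x) → (∀ c, G₂ (L' c) = G₁ c) → ∃ U : Set (EuclideanSpace ℝ (Fin p)), U ∈ residual (EuclideanSpace ℝ (Fin p)) ∧ ∀ v ∈ U, ∃ δ : ℝ, 0 < δ ∧ ∀ t : ℝ, t ≠ 0 → |t| < δ → ∀ 𝒟 : VacuumCauchyDevelopment (G₂ (t • v)),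
    (𝒟).IsMaximal → ∀ (Λ : lorentzGroup) (c : E4) (M a : ℝ), Kerr.IsExtremal M a → ¬ ∃ (τ₀ : ℝ) (Ψ :
    (boostedKerrBackground Λ c M a).domain → (𝒟).carrier), (𝒟).toSpacetime.IsLateChart (boostedKerrBackground Λ c M a)
    univ τ₀ Ψ ∧ (∀ ρ : ℝ, ∀ᶠ τ in atTop, ∀ x ∈ (boostedKerrBackground Λ c M a).truncTimeSlab ρ τ,
    (𝒟).timeOrientation.IsFutureDirected (mfderiv 𝓘(ℝ, E4) (𝓡 4) Ψ x ((Λ : E4 ≃L[ℝ] E4) (Kerr.timeVector M a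
    (poincareInv Λ c (x : E4)))))) ∧ ∀ R : ℝ, Tendsto (fun τ => (𝒟).toSpacetime.truncDeviationCk
    (boostedKerrBackground Λ c M a) Ψ 2 R τ) atTop (nhds 0)

set_option quotPrecheck false in
/-- `residTO(X, d)`: RESIDUAL a-priori tameness of the outer region at the datum `d` — verbatim the registered
kernel stub `stub_tameOuterResidual` after `∀ d ∈ admissibleVacuumData X,`. -/
local notation "residTO(" X ", " d ")" =>
    ∀ (m : ℕ) (G : EuclideanSpace ℝ (Fin m) → InitialDataSet (𝓡 3) X),
    (InitialDataSet.IsSmoothDataFamily m G ∧ G 0 = d ∧ (∀ c, G c ∈ admissibleVacuumData X) ∧ ∃ K : Set X,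
    IsCompact K ∧ ∀ c, ∀ x ∉ K, (G c).h.inner x = (d).h.inner x ∧ (G c).k x = (d).k x) → ∃ (n : ℕ) (G₁ :
    EuclideanSpace ℝ (Fin n) → InitialDataSet (𝓡 3) X) (L : EuclideanSpace ℝ (Fin m) →ₗ[ℝ] EuclideanSpace ℝ (Fin
    n)), Injective L ∧ (InitialDataSet.IsSmoothDataFamily n G₁ ∧ G₁ 0 = d ∧ (∀ c, G₁ c ∈ admissibleVacuumData X) ∧
    ∃ K : Set X, IsCompact K ∧ ∀ c, ∀ x ∉ K, (G₁ c).h.inner x = (d).h.inner x ∧ (G₁ c).k x = (d).k x) ∧ (∀ c, G₁ (L c)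
    = G c) ∧ ∀ (p : ℕ) (G₂ : EuclideanSpace ℝ (Fin p) → InitialDataSet (𝓡 3) X) (L' : EuclideanSpace ℝ (Fin n)
    →ₗ[ℝ] EuclideanSpace ℝ (Fin p)), Injective L' → (InitialDataSet.IsSmoothDataFamily p G₂ ∧ G₂ 0 = d ∧ (∀ c, G₂
    c ∈ admissibleVacuumData X) ∧ ∃ K : Set X, IsCompact K ∧ ∀ c, ∀ x ∉ K, (G₂ c).h.inner x = (d).h.inner x ∧ (G₂
    c).k x = (d).k x) → (∀ c, G₂ (L' c) = G₁ c) → ∃ U : Set (EuclideanSpace ℝ (Fin p)), U ∈ residual (EuclideanSpace ℝ (Fin p)) ∧ ∀ v ∈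
    U, ∃ δ : ℝ, 0 < δ ∧ ∀ t : ℝ, t ≠ 0 → |t| < δ → ∀ 𝒟 : VacuumCauchyDevelopment (G₂ (t • v)), (𝒟).IsMaximal → outerTame(X, 𝒟)

set_option quotPrecheck false in
/-- `robustCNI(X, d)`: ROBUST escapability of "every MGHD has complete null infinity" at the datum `d` — verbatim
the body of `Theses.RobustClausewiseGenericity.CensorshipRobust` (stmt-10131) after `∀ d ∈ admissibleVacuumData X,`. -/
local notation "robustCNI(" X ", " d ")" =>
    let Tame : (m : ℕ) → (EuclideanSpace ℝ (Fin m) → InitialDataSet (𝓡 3) X) → Prop := fun m G ↦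
        InitialDataSet.IsSmoothDataFamily m G ∧ G 0 = d ∧ (∀ c, G c ∈ admissibleVacuumData X) ∧ ∃ K : Set X,
        IsCompact K ∧ ∀ c, ∀ x ∉ K, (G c).h.inner x = (d).h.inner x ∧ (G c).k x = (d).k x;
    let Q : InitialDataSet (𝓡 3) X → Prop := fun D ↦ ∀ 𝒟 : VacuumCauchyDevelopment D, (𝒟).IsMaximal →
        HasCompleteNullInfinity (𝒟).toCauchyDevelopment;
    ∀ (m : ℕ) (G : EuclideanSpace ℝ (Fin m) → InitialDataSet (𝓡 3) X), Tame m G → ∃ (n : ℕ) (G₁ : EuclideanSpace ℝ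
    (Fin n) → InitialDataSet (𝓡 3) X) (L : EuclideanSpace ℝ (Fin m) →ₗ[ℝ] EuclideanSpace ℝ (Fin n)), Function.Injective
    L ∧ Tame n G₁ ∧ (∀ c, G₁ (L c) = G c) ∧ ∀ (p : ℕ) (G₂ : EuclideanSpace ℝ (Fin p) → InitialDataSet (𝓡 3) X) (L' :
    EuclideanSpace ℝ (Fin n) →ₗ[ℝ] EuclideanSpace ℝ (Fin p)), Function.Injective L' → Tame p G₂ → (∀ c, G₂ (L' c) =
    G₁ c) → ∃ U : Set (EuclideanSpace ℝ (Fin p)), IsOpen U ∧ Dense U ∧ ∀ v ∈ U, ∃ δ : ℝ, 0 < δ ∧ ∀ t : ℝ, t ≠ 0 →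
    |t| < δ → Q (G₂ (t • v))

set_option quotPrecheck false in
/-- `k3Prop(X)`: the K3 property of data on `X` — verbatim the property in the body of
`Theses.PhotonSphereChannels.TameCensorship` (stmt-17431): an MGHD exists and every MGHD has (a) complete `𝓘⁺`,
(i) `extFree`, (ii) `outerTame`. -/
local notation "k3Prop(" X ")" =>
    (fun D => (∃ 𝒟 : VacuumCauchyDevelopment D, (𝒟).IsMaximal) ∧ ∀ 𝒟 : VacuumCauchyDevelopment D, (𝒟).IsMaximal →
      HasCompleteNullInfinity (𝒟).toCauchyDevelopment ∧ (extFree(𝒟) ∧ outerTame(X, 𝒟)))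


/-- **The split theorem: `TameCensorship` (K3, tame form; body verbatim) from four clause-wise pieces.** Hypotheses,
in the order of the route split `FGExtremalChartFreeResidual → TameOuterResidual → MGHDExists → CensorshipRobust →
TameCensorship`: (1) the FUTURE-GOING RESIDUAL DYNAMICAL THIRD LAW in late-chart form — at every admissible datum the
property "every MGHD has no late chart modelled on a boosted extremal Kerr exterior, with push-forward of the Kerr–Schild
time vector eventually future-directed on truncated slabs and truncated `C²` deviation `→ 0`" is residually escapable
(verbatim the registered open kernel `stub_fgExtremalChartFreeResidual` of line `Sketch`, skeleton v9; open problem —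
Kehle–Unger arXiv:2402.10190, Angelopoulos–Kehle–Unger arXiv:2410.16234 for the model picture); (2) RESIDUAL A-PRIORI
TAMENESS — at every admissible datum the property "every MGHD has `C³`-bounded geometry of
`outer = J⁺(ιΣ) ∩ ⋃ I⁻(future-complete normalised rays)` at one scale with `C⁰`-deviation `≤ ½`" is residually escapable
(verbatim the registered open kernel `stub_tameOuterResidual`; open problem, no mechanism in print); (3) the body of
`MGHDExists` (item stmt-FinalStateConjecture-9937, Choquet-Bruhat–Geroch); (4) the body of `CensorshipRobust` (item
stmt-FinalStateConjecture-10131, weak cosmic censorship in robust positive-codimension form). Conclusion: the body of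
`Theses.PhotonSphereChannels.TameCensorship` (stmt-FinalStateConjecture-17431) verbatim. Proof: per `X`, the engine
`isTameChristodoulouGeneric_of_residual` with `Q D` = "(a) ∧ ((i) ∧ (ii)) for every MGHD of `D`" and `P` = the K3
property: gauge invariance of `P` is `stub_qK3ComapIff` (p135447), `Q ⇒ P` on admissible data by (3), and `Q` is residual
at every admissible datum by `stub_residualAnd` from (4) (made residual by `stub_residualOfRobust`),
`residual_extremalChartFree_of_fg` (1) and (2). [folklore] -/
theorem tameCensorship_of_subs :
    (∀ (X : Type) [TopologicalSpace X] [ChartedSpace E3 X] [IsManifold (𝓡 3) ∞ X] [T2Space X]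
    [SecondCountableTopology X] [ConnectedSpace X], ∀ d ∈ admissibleVacuumData X, residFG(X, d)) →
    (∀ (X : Type) [TopologicalSpace X] [ChartedSpace E3 X] [IsManifold (𝓡 3) ∞ X] [T2Space X]
    [SecondCountableTopology X] [ConnectedSpace X], ∀ d ∈ admissibleVacuumData X, residTO(X, d)) →
    (∀ (X : Type) [TopologicalSpace X] [ChartedSpace E3 X] [IsManifold (𝓡 3) ∞ X] [T2Space X]
    [SecondCountableTopology X] [ConnectedSpace X], ∀ D ∈ admissibleVacuumData X, ∃ 𝒟 : VacuumCauchyDevelopment D,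
    𝒟.IsMaximal) →
    (∀ (X : Type) [TopologicalSpace X] [ChartedSpace E3 X] [IsManifold (𝓡 3) ∞ X] [T2Space X]
    [SecondCountableTopology X] [ConnectedSpace X], ∀ d ∈ admissibleVacuumData X, robustCNI(X, d)) →
    ∀ (X : Type) [TopologicalSpace X] [ChartedSpace E3 X] [IsManifold (𝓡 3) ∞ X] [T2Space X]
    [SecondCountableTopology X] [ConnectedSpace X],
    InitialDataSet.IsTameChristodoulouGeneric (admissibleVacuumData X) k3Prop(X) 1 := by
  intro hFG hTO hM hC X _ _ _ _ _ _
  -- residual (i) at every admissible datum of `X`, from the future-going kernel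
  have hI := residual_extremalChartFree_of_fg (fun Y _ _ _ _ _ _ d hd => hFG Y d hd) X
  refine isTameChristodoulouGeneric_of_residual X
    (fun D => (∀ 𝒟 : VacuumCauchyDevelopment D, 𝒟.IsMaximal → HasCompleteNullInfinity 𝒟.toCauchyDevelopment) ∧
      ((∀ 𝒟 : VacuumCauchyDevelopment D, 𝒟.IsMaximal → extFree(𝒟)) ∧
        ∀ 𝒟 : VacuumCauchyDevelopment D, 𝒟.IsMaximal → outerTame(X, 𝒟)))
    _ (fun D Φ hΦ hΦ' hΨ hΨ' _ h => (stub_qK3ComapIff X D Φ hΦ hΦ' hΨ hΨ').2 h)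
    (fun D hD h => ⟨hM X D hD, fun 𝒟 h𝒟 => ⟨h.1 𝒟 h𝒟, h.2.1 𝒟 h𝒟, h.2.2 𝒟 h𝒟⟩⟩) fun d hd => ?_
  exact stub_residualAnd X d
    (fun D => ∀ 𝒟 : VacuumCauchyDevelopment D, 𝒟.IsMaximal → HasCompleteNullInfinity 𝒟.toCauchyDevelopment)
    (fun D => (∀ 𝒟 : VacuumCauchyDevelopment D, 𝒟.IsMaximal → extFree(𝒟)) ∧
      ∀ 𝒟 : VacuumCauchyDevelopment D, 𝒟.IsMaximal → outerTame(X, 𝒟))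
    (stub_residualOfRobust X d
      (fun D => ∀ 𝒟 : VacuumCauchyDevelopment D, 𝒟.IsMaximal → HasCompleteNullInfinity 𝒟.toCauchyDevelopment)
      (hC X d hd))
    (stub_residualAnd X d (fun D => ∀ 𝒟 : VacuumCauchyDevelopment D, 𝒟.IsMaximal → extFree(𝒟))
      (fun D => ∀ 𝒟 : VacuumCauchyDevelopment D, 𝒟.IsMaximal → outerTame(X, 𝒟)) (hI d hd) (hTO X d hd))

end SplitGlue

end Summit.FinalStateConjecture.FinalStateConjecture.Theorems.PhotonSphereChannels.TameCensorshipSplit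

end
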